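import Literature.Computability.MetaComplexity.GadgetClosure
import HarnessLib

/-!
# The closure of a linear system over blocks of variables: the pivot form

The block-closure lemma of Efremenko–Garlík–Itsykson (STOC 2024, §4; tree: `AffSys.exists_closure`
on a finite window, `GadgetClosure.exists_gadgetClosure` for gadget values) in the form needed when
the blocks are read through a MULTI-BIT function rather than a one-bit gadget — the binary
pigeonhole principle `BPHP`, where block `x` holds the `a` bits of the hole of pigeon `x`
[Efremenko–Garlík–Itsykson 2024, §1.3.2–1.3.3, §5]: for every linear system `F` over `𝔽₂` in the
variables `x·a + j` there are a set `Q` of blocks, `Q = ∅` or `|Q| + 1 ≤ rk F`, and ONE PIVOT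
POSITION `p x` per block, such that every assignment can be modified, keeping every linear form of
`F` and every block of `Q`, so that ALL NON-PIVOT POSITIONS of all blocks outside `Q` take
arbitrary prescribed bits (`BlockFree`, `exists_blockClosure`; monotone under `L(G) ⊆ ⟨L(F)⟩`,
`BlockFree.mono`). [Efremenko–Garlík–Itsykson 2024, Thm 3.1 + §4 ("we can assign values to all
variables except the chosen `k` … arbitrarily"); Alekseev–Itsykson 2025, Lemma 2.9]

## References

* K. Efremenko, M. Garlík, D. Itsykson, *Lower bounds for regular resolution over parities*,
  STOC 2024, §3 (Thm 3.1), §4 (closure), §5 (locally consistent systems for `BPHP`)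
  [EfremenkoGarlikItsykson2024].
* Y. Alekseev, D. Itsykson, STOC 2025, §2.4–2.5, Lemma 2.9 [AlekseevItsykson2025].
-/

namespace Literature.Computability.MetaComplexity

open _root_.Computability Complexity Finset Module

/-- **`Q` and the pivots `p` free the non-pivot positions of `F` outside `Q`**: every assignment `σ`
can be changed to `σ'` giving the same value to every linear form of `F`, agreeing with `σ` on the
blocks of `Q`, and with `σ' (x·a + j) = τ (x·a + j)` for every block `x ∉ Q` and every position
`j ≠ p x`. [Efremenko–Garlík–Itsykson 2024, §4 (closure); Alekseev–Itsykson 2025, Lemma 2.9]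
[cite: EfremenkoGarlikItsykson2024, Thm 3.1] -/
def BlockFree (a : ℕ) (F : Finset LinLit) (Q : Finset ℕ) (p : ℕ → Fin a) : Prop :=
  ∀ σ τ : ℕ → Bool, ∃ σ' : ℕ → Bool,
    (∀ e ∈ F, ∀ b : Bool, LinLit.eval σ' (e.1, b) = LinLit.eval σ (e.1, b)) ∧
    (∀ x ∈ Q, ∀ j : Fin a, σ' (x * a + j) = σ (x * a + j)) ∧
    (∀ x, x ∉ Q → ∀ j : Fin a, j ≠ p x → σ' (x * a + j) = τ (x * a + j))

/-- Monotonicity of freeness in the system: if `(Q, p)` frees `F` and every form of `G` lies in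
`⟨L(F)⟩`, then `(Q, p)` frees `G`. [Efremenko–Garlík–Itsykson 2024, §4 (Lemma 4.4 ff.: the closure
depends on the span only)] [cite: EfremenkoGarlikItsykson2024, Thm 3.1] -/
theorem BlockFree.mono {a : ℕ} {F G : Finset LinLit} {Q : Finset ℕ} {p : ℕ → Fin a}
    (hF : BlockFree a F Q p)
    (hG : ∀ e ∈ G, linFormVec e.1 ∈ Submodule.span (ZMod 2) (LinClause.forms F)) :
    BlockFree a G Q p := by
  intro σ τ
  obtain ⟨σ', hforms, hQ, hfree⟩ := hF σ τ
  refine ⟨σ', fun e he b => ?_, hQ, hfree⟩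
  apply linLit_eval_eq_of_sum_eq
  exact sum_eq_sum_of_mem_span (hG e he) fun e' he' => sum_eq_of_linLit_eval_eq (hforms e' he')

/-! ### Window helpers (local copies) -/

/-- A linear form restricted to the window `{0, …, n-1}` (local copy). [folklore] -/
private def formWin (n : ℕ) (f : Finset ℕ) : Fin n → ZMod 2 := fun v => if (v : ℕ) ∈ f then 1 else 0

/-- Extension by zero from the window to `ℕ` (local copy). [folklore] -/
private def extWin (n : ℕ) (z : Fin n → ZMod 2) : ℕ → ZMod 2 :=
  fun v => if h : v < n then z ⟨v, h⟩ else 0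

/-- The pairing of a restricted form with a window vector is the parity sum of the form (local copy).
[folklore] -/
private theorem formWin_dotProduct {n : ℕ} {f : Finset ℕ} (hf : ∀ i ∈ f, i < n) (z : ℕ → ZMod 2) :
    formWin n f ⬝ᵥ (fun v : Fin n => z v) = ∑ i ∈ f, z i := by
  unfold dotProduct formWin
  have h1 : ∑ v : Fin n, (if (v : ℕ) ∈ f then (1 : ZMod 2) else 0) * z v =
      ∑ v : Fin n, (fun i : ℕ => if i ∈ f then z i else 0) v :=
    Finset.sum_congr rfl fun v _ => by by_cases hv : (v : ℕ) ∈ f <;> simp [hv]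
  rw [h1, Fin.sum_univ_eq_sum_range (fun i : ℕ => if i ∈ f then z i else 0) n,
    Finset.sum_ite_mem]
  have hfr : Finset.range n ∩ f = f :=
    Finset.inter_eq_right.2 fun i hi => Finset.mem_range.2 (hf i hi)
  rw [hfr]

/-- The block of the variable `x·a + j` is `x` (local copy). [folklore] -/
private theorem blk_div {a x j : ℕ} (ha : 0 < a) (hj : j < a) : (x * a + j) / a = x := by
  rw [Nat.add_comm, Nat.add_mul_div_right _ _ ha, Nat.div_eq_of_lt hj, zero_add]

/-- The position of the variable `x·a + j` is `j` (local copy). [folklore] -/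
private theorem blk_mod {a x j : ℕ} (hj : j < a) : (x * a + j) % a = j := by
  rw [Nat.add_comm, Nat.add_mul_mod_self_right, Nat.mod_eq_of_lt hj]

/-! ### The closure lemma, pivot form -/

/-- **Closure of a linear system over blocks, with pivots** [Efremenko–Garlík–Itsykson 2024, §4;
Alekseev–Itsykson 2025, Lemmas 2.7, 2.9]. For `a ≥ 1` and every linear system `F` over `𝔽₂` in the
variables `x·a + j` there are a set `Q` of blocks with `Q = ∅` or `|Q| + 1 ≤ linClauseRank F` and
pivot positions `p` freeing the non-pivot positions of `F` outside `Q` (`BlockFree`). (The tree's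
`AffSys.exists_closure` on the window of the first `M` blocks, applied to the homogeneous system
`L(F) = 0`, a solution of which is added to the given assignment; blocks past the window are
entirely free.) [cite: EfremenkoGarlikItsykson2024, Thm 3.1] -/
theorem exists_blockClosure {a : ℕ} (ha : 0 < a) (F : Finset LinLit) :
    ∃ Q : Finset ℕ, (Q = ∅ ∨ Q.card + 1 ≤ linClauseRank F) ∧ ∃ p : ℕ → Fin a, BlockFree a F Q p := by
  classical
  -- ### the window: the first `M` blocks, `M` past every block met by `F`
  set M : ℕ := (F.biUnion (fun e => e.1)).sup (fun v => v / a) + 1 with hM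
  set n : ℕ := M * a with hn
  have hvarM : ∀ e ∈ F, ∀ v ∈ e.1, v / a < M := by
    intro e he v hv
    exact Nat.lt_succ_of_le (Finset.le_sup (f := fun v => v / a) (Finset.mem_biUnion.2 ⟨e, he, hv⟩))
  have hblock_lt : ∀ x j : ℕ, x < M → j < a → x * a + j < n := by
    intro x j hx hj
    calc x * a + j < x * a + a := by omega
      _ = (x + 1) * a := by ring
      _ ≤ M * a := Nat.mul_le_mul_right a hx
  have hvarn : ∀ e ∈ F, ∀ v ∈ e.1, v < n := by
    intro e he v hv
    have h1 := hvarM e he v hv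
    have h2 : v = v / a * a + v % a := (Nat.div_add_mod' v a).symm
    rw [h2]
    exact hblock_lt _ _ h1 (Nat.mod_lt v ha)
  -- the blocks of the window
  let bmap : Fin M → Fin a → Fin n := fun e i => ⟨(e : ℕ) * a + i, hblock_lt e i e.isLt i.isLt⟩
  have hbmap : ∀ e e' i i', bmap e i = bmap e' i' → e = e' ∧ i = i' := by
    intro e e' i i' h
    have h' : (e : ℕ) * a + i = (e' : ℕ) * a + i' := congrArg Fin.val h
    have he : (e : ℕ) = e' := by
      have := congrArg (· / a) h'
      simpa only [blk_div ha i.isLt, blk_div ha i'.isLt] using this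
    have hi : (i : ℕ) = i' := by
      have := congrArg (· % a) h'
      simpa only [blk_mod i.isLt, blk_mod i'.isLt] using this
    exact ⟨Fin.ext he, Fin.ext hi⟩
  -- ### the homogeneous system `L(F) = 0` on the window, its rank
  let Ψ : AffSys (Fin n) := F.image fun e => (formWin n e.1, (0 : ZMod 2))
  have hrank : finrank (ZMod 2) (AffSys.spanS Ψ) ≤ linClauseRank F := by
    let restr : (ℕ → ZMod 2) →ₗ[ZMod 2] (Fin n → ZMod 2) :=
      LinearMap.funLeft (ZMod 2) (ZMod 2) (Fin.val : Fin n → ℕ)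
    have hforms : (AffSys.forms Ψ : Set (Fin n → ZMod 2)) ⊆ restr '' LinClause.forms F := by
      intro w hw
      have hw' : w ∈ (F.image fun e => (formWin n e.1, (0 : ZMod 2))).image Prod.fst := hw
      rw [Finset.mem_image] at hw'
      obtain ⟨q, hq, rfl⟩ := hw'
      obtain ⟨e, he, rfl⟩ := Finset.mem_image.1 hq
      refine ⟨linFormVec e.1, LinClause.mem_forms_iff.2 ⟨e, he, rfl⟩, ?_⟩
      funext v
      simp [restr, LinearMap.funLeft_apply, linFormVec_apply, formWin]
    have hle : AffSys.spanS Ψ ≤ (Submodule.span (ZMod 2) (LinClause.forms F)).map restr := by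
      unfold AffSys.spanS
      rw [Submodule.map_span]
      exact Submodule.span_mono hforms
    rw [linClauseRank_eq]
    haveI : Module.Finite (ZMod 2) (Submodule.span (ZMod 2) (LinClause.forms F)) :=
      Module.Finite.span_of_finite (ZMod 2) (Set.finite_range _)
    exact (Submodule.finrank_mono hle).trans (Submodule.finrank_map_le restr _)
  -- ### the closure on the window
  obtain ⟨Q₀, hsize, p₀, hprod⟩ := AffSys.exists_closure ha bmap hbmap Ψ
  let p : ℕ → Fin a := fun x => if h : x < M then p₀ ⟨x, h⟩ else ⟨0, ha⟩
  refine ⟨Q₀.image Fin.val, ?_, p, ?_⟩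
  · rcases hsize with h | h
    · left; rw [h, Finset.image_empty]
    · right
      rw [Finset.card_image_of_injective _ Fin.val_injective]
      exact h.trans hrank
  -- ### freeness
  intro σ τ
  let t : Fin M → Fin a → ZMod 2 := fun e i =>
    (if τ ((e : ℕ) * a + i) = true then 1 else 0) - zOf σ ((e : ℕ) * a + i)
  have h0 : (0 : Fin n → ZMod 2) ∈ AffSys.Sol Ψ := by
    rw [AffSys.mem_Sol]
    intro q hq
    obtain ⟨e, -, rfl⟩ := Finset.mem_image.1 hq
    simp
  obtain ⟨β, hβ, hagree, hfreeβ⟩ := hprod 0 h0 t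
  -- the modified assignment: `σ ⊕ β` on the window, `τ` past the window
  let σ' : ℕ → Bool := fun v =>
    if h : v < n then xor (σ v) (decide (β ⟨v, h⟩ = 1)) else τ v
  have hσ'_in : ∀ (v : ℕ) (h : v < n), zOf σ' v = zOf σ v + β ⟨v, h⟩ := by
    intro v h
    have hcase : ∀ (s : Bool) (r : ZMod 2),
        (if xor s (decide (r = 1)) = true then (1 : ZMod 2) else 0) =
          (if s = true then 1 else 0) + r := by decide
    simp only [zOf_apply, σ', h, dif_pos]
    exact hcase (σ v) (β ⟨v, h⟩)
  refine ⟨σ', ?_, ?_, ?_⟩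
  · -- (A) the forms of `F` keep their values
    intro e he b
    apply linLit_eval_eq_of_sum_eq
    have hsum : ∑ i ∈ e.1, zOf σ' i = ∑ i ∈ e.1, (zOf σ i + extWin n β i) := by
      refine Finset.sum_congr rfl fun i hi => ?_
      have hin := hvarn e he i hi
      rw [hσ'_in i hin]
      simp [extWin, hin]
    rw [hsum, Finset.sum_add_distrib, add_eq_left]
    have hβe : formWin n e.1 ⬝ᵥ β = 0 :=
      AffSys.mem_Sol.1 hβ (formWin n e.1, 0) (Finset.mem_image_of_mem _ he)
    have hext : (fun v : Fin n => extWin n β v) = β := by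
      funext v; simp [extWin, v.isLt]
    rw [← formWin_dotProduct (hvarn e he) (extWin n β), hext, hβe]
  · -- (B) the blocks of `Q` are untouched
    intro x hx j
    obtain ⟨e, heQ, rfl⟩ := Finset.mem_image.1 hx
    have hin : (e : ℕ) * a + j < n := hblock_lt e j e.isLt j.isLt
    have hβ0 : β ⟨(e : ℕ) * a + j, hin⟩ = 0 := by
      have h1 := hagree (bmap e j) (fun e' he' i' h => he' ((hbmap e' e i' j h).1 ▸ heQ))
      simpa using h1
    have h2 : zOf σ' ((e : ℕ) * a + j) = zOf σ ((e : ℕ) * a + j) := by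
      rw [hσ'_in _ hin, hβ0, add_zero]
    have hcase : ∀ s s' : Bool,
        (if s' = true then (1 : ZMod 2) else 0) = (if s = true then 1 else 0) → s' = s := by decide
    exact hcase _ _ (by simpa only [zOf_apply] using h2)
  · -- (C) outside `Q` the non-pivot positions carry the targets
    intro x hx j hj
    by_cases hxM : x < M
    · let e : Fin M := ⟨x, hxM⟩
      have heQ : e ∉ Q₀ := fun h => hx (Finset.mem_image.2 ⟨e, h, rfl⟩)
      have hpe : p x = p₀ e := by simp [p, hxM, e]
      have hj' : j ≠ p₀ e := by rw [← hpe]; exact hj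
      have hin : x * a + j < n := hblock_lt x j hxM j.isLt
      have hβj : β ⟨x * a + j, hin⟩ = t e j := hfreeβ e heQ j hj'
      have h2 : zOf σ' (x * a + j) = if τ (x * a + j) = true then 1 else 0 := by
        rw [hσ'_in _ hin, hβj]
        simp only [t, e]
        ring
      have hcase : ∀ s s' : Bool,
          (if s' = true then (1 : ZMod 2) else 0) = (if s = true then 1 else 0) → s' = s := by decide
      exact hcase _ _ (by simpa only [zOf_apply] using h2)
    · have hge : ¬ x * a + (j : ℕ) < n := by
        intro hlt
        apply hxM
        by_contra hge
        have : M * a ≤ x * a := Nat.mul_le_mul_right a (Nat.le_of_not_lt hge)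
        omega
      simp [σ', hge]

end Literature.Computability.MetaComplexity
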